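import Mathlib.Analysis.SpecialFunctions.Pow.Real
import Mathlib.Analysis.Complex.Exponential
import HarnessLib

/-!
# Rates extracted from two-sided trace domination of a transfer operator — PROVED

Topic `Literature/Analysis/OperatorTheory` (transfer-matrix bookkeeping; written for crux `FibreAnchor`, route
`QuantumFields/ContractibleFibre`, stub `stub_traceFormulaClustering`; Mathlib only, no definitions).  Pure real analysis:
what the two-sided trace domination (VDR)
`λ₀^{m+2} ≤ Z_m = Σᵢ λᵢ^{m+2} ≤ λ₀^{m+2} exp(E e^{−m₀(m+2)})` (`m + 2 ≤ N`) and the threshold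
`(4/m₀) log(2+E) + 4(w+1) ≤ N` give for the eigenvalue family `0 ≤ λᵢ ≤ λ_{i₀}`:

* `top_pos_of_vdr` — `0 < λ_{i₀}` and `λ₀ ≤ λ_{i₀}`;
* `tsum_ratio_pow_le` — the normalised traces `Σ (λᵢ/λ_{i₀})^{m+2} ≤ exp(E e^{−m₀(m+2)})`;
* `ratio_le_of_tsum_pow_le` — the spectral ratio off the vacuum from one normalised trace;
* `threshold_numerics` — the elementary inequalities extracted from the threshold;
* `vdr_rates` (**main**) — `λᵢ ≤ e^{−m₀/2} λ_{i₀}` off `i₀`, the long-arc trace excess `R ≤ 1`, and the final numerical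
  bound `2 θ^{n−w−1} + 6 R ≤ 64 e^{m₀(w+1)} e^{−(m₀/2) n}`.

[folklore]
-/

set_option autoImplicit false

noncomputable section

namespace Literature.Analysis.OperatorTheory

open scoped BigOperators
open Filter

/-- **The top eigenvalue dominates the VDR scale**: if `Z_m = Σ λᵢ^{m+2}` with `0 ≤ λᵢ ≤ λ_{i₀}` and
`λ₀^{m+2} ≤ Z_m` for all `m` with `λ₀ > 0`, then `0 < λ_{i₀}` and `λ₀ ≤ λ_{i₀}` (else `(λ₀/λ_{i₀})^m ≤ Z_0/λ₀²`
for all `m`). [folklore] -/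
theorem top_pos_of_vdr {ι : Type*} {lam : ι → ℝ} {i₀ : ι} (hlam : ∀ i, 0 ≤ lam i ∧ lam i ≤ lam i₀)
    {Zf : ℕ → ℝ} (hZ : ∀ m, HasSum (fun i => lam i ^ (m + 2)) (Zf m)) {lam₀ : ℝ} (hlam₀ : 0 < lam₀)
    (hlow : ∀ m, lam₀ ^ (m + 2) ≤ Zf m) : 0 < lam i₀ ∧ lam₀ ≤ lam i₀ := by
  have hL : 0 < lam i₀ := by
    by_contra h
    push Not at h
    have hzero : ∀ i, lam i = 0 := fun i => le_antisymm ((hlam i).2.trans h) (hlam i).1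
    have h0 : HasSum (fun i => lam i ^ (0 + 2)) 0 := by
      have : (fun i => lam i ^ (0 + 2)) = 0 := funext fun i => by simp [hzero i]
      rw [this]; exact hasSum_zero
    have hZ0 : Zf 0 = 0 := (hZ 0).unique h0
    have h1 := hlow 0
    rw [hZ0] at h1
    exact absurd h1 (not_le.2 (pow_pos hlam₀ _))
  refine ⟨hL, ?_⟩
  by_contra h
  push Not at h
  have hup : ∀ m, Zf m ≤ lam i₀ ^ m * Zf 0 := fun m =>
    hasSum_le (fun i => by
      rw [zero_add, pow_add]
      exact mul_le_mul_of_nonneg_right (pow_le_pow_left₀ (hlam i).1 (hlam i).2 m) (sq_nonneg _))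
      (hZ m) ((hZ 0).mul_left (lam i₀ ^ m))
  obtain ⟨m, hm⟩ := pow_unbounded_of_one_lt (Zf 0 / lam₀ ^ 2) ((one_lt_div hL).2 h)
  have h1 : lam₀ ^ (m + 2) ≤ lam i₀ ^ m * Zf 0 := (hlow m).trans (hup m)
  have h2 : (lam₀ / lam i₀) ^ m ≤ Zf 0 / lam₀ ^ 2 := by
    rw [div_pow, div_le_div_iff₀ (pow_pos hL m) (pow_pos hlam₀ 2)]
    calc lam₀ ^ m * lam₀ ^ 2 = lam₀ ^ (m + 2) := (pow_add _ _ _).symm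
      _ ≤ lam i₀ ^ m * Zf 0 := h1
      _ = Zf 0 * lam i₀ ^ m := mul_comm _ _
  exact absurd hm (not_lt.2 h2)

/-- **Normalised traces**: `Σᵢ (λᵢ/λ_{i₀})^{m+2} ≤ B` as soon as `Z_m ≤ λ₀^{m+2} B` with `λ₀ ≤ λ_{i₀}`. [folklore] -/
theorem tsum_ratio_pow_le {ι : Type*} {lam : ι → ℝ} {i₀ : ι} {Zf : ℕ → ℝ}
    (hZ : ∀ m, HasSum (fun i => lam i ^ (m + 2)) (Zf m)) {lam₀ : ℝ} (hlam₀ : 0 < lam₀) (hL : 0 < lam i₀)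
    (hle : lam₀ ≤ lam i₀) {B : ℝ} (hB : 0 ≤ B) (m : ℕ) (hup : Zf m ≤ lam₀ ^ (m + 2) * B) :
    ∑' i, (lam i / lam i₀) ^ (m + 2) ≤ B := by
  have h := ((hZ m).div_const (lam i₀ ^ (m + 2))).tsum_eq
  have e : (fun i => (lam i / lam i₀) ^ (m + 2)) = fun i => lam i ^ (m + 2) / lam i₀ ^ (m + 2) :=
    funext fun i => div_pow _ _ _
  rw [e, h, div_le_iff₀ (pow_pos hL _)]
  calc Zf m ≤ lam₀ ^ (m + 2) * B := hup
    _ ≤ lam i₀ ^ (m + 2) * B := mul_le_mul_of_nonneg_right (pow_le_pow_left₀ hlam₀.le hle _) hB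
    _ = B * lam i₀ ^ (m + 2) := mul_comm _ _

/-- **Spectral ratio off the vacuum from a single normalised trace**: if `Σᵢ (λᵢ/λ_{i₀})ᴺ ≤ exp x` with
`0 ≤ x ≤ 1` and `2x ≤ θᴺ`, then `λᵢ ≤ θ λ_{i₀}` for every `i ≠ i₀` (the vacuum term alone contributes `1`, and
`exp x − 1 ≤ 2x`). [folklore] -/
theorem ratio_le_of_tsum_pow_le {ι : Type*} {lam : ι → ℝ} {i₀ : ι} (hlam : ∀ i, 0 ≤ lam i ∧ lam i ≤ lam i₀)
    (hL : 0 < lam i₀) {N : ℕ} (hN : N ≠ 0) (hsum : Summable fun i => (lam i / lam i₀) ^ N) {x θ : ℝ}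
    (hθ : 0 ≤ θ) (hx0 : 0 ≤ x) (hx1 : x ≤ 1) (hxθ : 2 * x ≤ θ ^ N)
    (hup : ∑' i, (lam i / lam i₀) ^ N ≤ Real.exp x) (i : ι) (hi : i ≠ i₀) : lam i ≤ θ * lam i₀ := by
  classical
  have hρ0 : ∀ j, 0 ≤ lam j / lam i₀ := fun j => div_nonneg (hlam j).1 hL.le
  have h1 : ∑ j ∈ ({i, i₀} : Finset ι), (lam j / lam i₀) ^ N ≤ ∑' j, (lam j / lam i₀) ^ N :=
    sum_le_hasSum _ (fun j _ => pow_nonneg (hρ0 j) N) hsum.hasSum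
  rw [Finset.sum_pair hi, div_self hL.ne', one_pow] at h1
  have h3 : Real.exp x - 1 ≤ 2 * x := by
    have h := Real.abs_exp_sub_one_le (x := x) (by rw [abs_of_nonneg hx0]; exact hx1)
    rw [abs_of_nonneg hx0] at h
    exact (le_abs_self _).trans h
  have h2 : (lam i / lam i₀) ^ N ≤ θ ^ N := by linarith
  have h4 : lam i / lam i₀ ≤ θ := (pow_le_pow_iff_left₀ (hρ0 i) hθ hN).1 h2
  rwa [div_le_iff₀ hL] at h4

/-- **The elementary inequalities extracted from the threshold** `(4/m₀) log(2+E) + 4(w+1) ≤ N` for a period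
`N = 2w + a + b' + 6`, separation `n = w + a + 3` with `2n < N`: with `q = e^{−m₀N/4}` one has `(2+E) q ≤ 1` and
`(2+E) e^{m₀(w+1)} q ≤ 1`, whence the listed bounds for the gap scale `E e^{−m₀N}`, the long-arc scale
`x = E e^{−m₀(b'+2)}` and the final rate. [folklore] -/
theorem threshold_numerics {m₀ E : ℝ} (hm₀ : 0 < m₀) (hE : 0 ≤ E) {N w n a b' : ℕ}
    (hthr : 4 / m₀ * Real.log (2 + E) + 4 * (w + 1) ≤ (N : ℝ)) (hn : 2 * n < N)
    (hN : N = 2 * w + a + b' + 4 + 2) (hna : w + a + 3 = n) :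
    E * Real.exp (-(m₀ * N)) ≤ 1 ∧
    2 * (E * Real.exp (-(m₀ * N))) ≤ Real.exp (-(m₀ / 2)) ^ N ∧
    E * Real.exp (-(m₀ * ((b' : ℝ) + 2))) ≤ 1 ∧
    Real.exp (E * Real.exp (-(m₀ * ((b' : ℝ) + 2)))) - 1 ≤ 1 ∧
    2 * Real.exp (-(m₀ / 2)) ^ (a + 2) + 6 * (Real.exp (E * Real.exp (-(m₀ * ((b' : ℝ) + 2)))) - 1) ≤
      64 * Real.exp (m₀ * (w + 1)) * Real.exp (-(m₀ / 2 * n)) := by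
  have h2E : 0 < 2 + E := by linarith
  have hw0 : (0 : ℝ) ≤ (w : ℝ) + 1 := by positivity
  -- casts of the combinatorial relations
  have hNr : (N : ℝ) = 2 * w + a + b' + 6 := by rw [hN]; push_cast; ring
  have hnr : (n : ℝ) = w + a + 3 := by rw [← hna]; push_cast; ring
  have hab : (a : ℝ) ≤ b' := by exact_mod_cast (show a ≤ b' by omega)
  have h2n : 2 * (n : ℝ) ≤ N := by exact_mod_cast hn.le
  -- the threshold in exponential form
  have hlog : Real.log (2 + E) + m₀ * (w + 1) ≤ m₀ * N / 4 := by
    have h := mul_le_mul_of_nonneg_left hthr (le_of_lt (div_pos hm₀ four_pos))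
    calc Real.log (2 + E) + m₀ * (w + 1) = m₀ / 4 * (4 / m₀ * Real.log (2 + E) + 4 * (w + 1)) := by
          field_simp
      _ ≤ m₀ / 4 * N := h
      _ = m₀ * N / 4 := by ring
  have hlog' : Real.log (2 + E) ≤ m₀ * N / 4 := by nlinarith [mul_nonneg hm₀.le hw0]
  set q : ℝ := Real.exp (-(m₀ * N / 4)) with hq
  have hq0 : 0 < q := Real.exp_pos _
  have hqinv : Real.exp (m₀ * N / 4) * q = 1 := by
    rw [hq, ← Real.exp_add, add_neg_cancel, Real.exp_zero]
  have hq1 : (2 + E) * q ≤ 1 := by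
    calc (2 + E) * q ≤ Real.exp (m₀ * N / 4) * q := by
          refine mul_le_mul_of_nonneg_right ?_ hq0.le
          calc 2 + E = Real.exp (Real.log (2 + E)) := (Real.exp_log h2E).symm
            _ ≤ Real.exp (m₀ * N / 4) := Real.exp_le_exp.2 hlog'
      _ = 1 := hqinv
  have hq2 : (2 + E) * Real.exp (m₀ * (w + 1)) * q ≤ 1 := by
    calc (2 + E) * Real.exp (m₀ * (w + 1)) * q ≤ Real.exp (m₀ * N / 4) * q := by
          refine mul_le_mul_of_nonneg_right ?_ hq0.le
          calc (2 + E) * Real.exp (m₀ * (w + 1)) = Real.exp (Real.log (2 + E) + m₀ * (w + 1)) := by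
                rw [Real.exp_add, Real.exp_log h2E]
            _ ≤ Real.exp (m₀ * N / 4) := Real.exp_le_exp.2 hlog
      _ = 1 := hqinv
  have hq12 : q ≤ 1 / 2 := by nlinarith [mul_nonneg hE hq0.le]
  have hqle1 : q ≤ 1 := hq12.trans (by norm_num)
  have hEq : E * q ≤ 1 := by nlinarith [hq0]
  -- (1), (2): the gap scale `E e^{−m₀ N} = E q⁴`
  have hq4 : Real.exp (-(m₀ * N)) = q ^ 4 := by
    rw [hq, ← Real.exp_nat_mul]; congr 1; push_cast; ring
  have hθN : Real.exp (-(m₀ / 2)) ^ N = q ^ 2 := by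
    rw [hq, ← Real.exp_nat_mul, ← Real.exp_nat_mul]; congr 1; push_cast; ring
  have c1 : E * Real.exp (-(m₀ * N)) ≤ 1 := by
    rw [hq4]
    calc E * q ^ 4 = E * q * q ^ 3 := by ring
      _ ≤ 1 * 1 := mul_le_mul hEq (pow_le_one₀ hq0.le hqle1) (by positivity) zero_le_one
      _ = 1 := one_mul _
  have c2 : 2 * (E * Real.exp (-(m₀ * N))) ≤ Real.exp (-(m₀ / 2)) ^ N := by
    rw [hq4, hθN]
    have h1 : 2 * E * q ^ 2 ≤ 1 := by
      calc 2 * E * q ^ 2 ≤ (2 + E) ^ 2 * q ^ 2 := by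
            refine mul_le_mul_of_nonneg_right ?_ (sq_nonneg _); nlinarith [sq_nonneg E]
        _ = ((2 + E) * q) ^ 2 := by ring
        _ ≤ 1 := pow_le_one₀ (by positivity) hq1
    calc 2 * (E * q ^ 4) = 2 * E * q ^ 2 * q ^ 2 := by ring
      _ ≤ 1 * q ^ 2 := mul_le_mul_of_nonneg_right h1 (sq_nonneg _)
      _ = q ^ 2 := one_mul _
  -- (3), (4): the long-arc scale `x = E e^{−m₀(b'+2)} ≤ q ≤ 1/2`
  set x : ℝ := E * Real.exp (-(m₀ * ((b' : ℝ) + 2))) with hx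
  have hx0 : 0 ≤ x := by positivity
  have hexp : Real.exp (-(m₀ * ((b' : ℝ) + 2))) ≤ Real.exp (m₀ * (w + 1)) * q ^ 2 := by
    rw [hq, ← Real.exp_nat_mul, ← Real.exp_add]
    refine Real.exp_le_exp.2 ?_
    have key : m₀ * ((w : ℝ) + 1) + ((2 : ℕ) : ℝ) * (-(m₀ * N / 4)) - (-(m₀ * ((b' : ℝ) + 2))) =
        m₀ * (((b' : ℝ) - a) / 2) := by
      rw [hNr]; push_cast; ring
    have hpos : 0 ≤ m₀ * (((b' : ℝ) - a) / 2) := mul_nonneg hm₀.le (by linarith)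
    linarith
  have hxq : x ≤ q := by
    calc x ≤ E * (Real.exp (m₀ * (w + 1)) * q ^ 2) := mul_le_mul_of_nonneg_left hexp hE
      _ = E * Real.exp (m₀ * (w + 1)) * q * q := by ring
      _ ≤ (2 + E) * Real.exp (m₀ * (w + 1)) * q * q := by gcongr; linarith
      _ ≤ 1 * q := mul_le_mul_of_nonneg_right hq2 hq0.le
      _ = q := one_mul _
  have hx1 : x ≤ 1 := hxq.trans hqle1
  have hR2 : Real.exp x - 1 ≤ 2 * x := by
    have h := Real.abs_exp_sub_one_le (x := x) (by rw [abs_of_nonneg hx0]; exact hx1)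
    rw [abs_of_nonneg hx0] at h
    exact (le_abs_self _).trans h
  have c3 : x ≤ 1 := hx1
  have c4 : Real.exp x - 1 ≤ 1 := by nlinarith
  -- (5): the rate
  set D : ℝ := Real.exp (-(m₀ / 2 * n)) with hD
  set P : ℝ := Real.exp (m₀ * (w + 1)) with hP
  have hD0 : 0 < D := Real.exp_pos _
  have hP1 : 1 ≤ P := by rw [hP]; exact Real.one_le_exp (mul_nonneg hm₀.le hw0)
  have hqD : q ≤ D := by
    rw [hq, hD]
    refine Real.exp_le_exp.2 ?_
    have key : -(m₀ / 2 * (n : ℝ)) - (-(m₀ * N / 4)) = m₀ / 4 * ((N : ℝ) - 2 * n) := by ring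
    have hpos : 0 ≤ m₀ / 4 * ((N : ℝ) - 2 * n) := mul_nonneg (by positivity) (by linarith)
    linarith
  have hθa : Real.exp (-(m₀ / 2)) ^ (a + 2) ≤ P * D := by
    rw [hP, hD, ← Real.exp_nat_mul, ← Real.exp_add]
    refine Real.exp_le_exp.2 ?_
    have key : m₀ * ((w : ℝ) + 1) + -(m₀ / 2 * (n : ℝ)) - ((a + 2 : ℕ) : ℝ) * -(m₀ / 2) = m₀ / 2 * ((w : ℝ) + 1) := by
      rw [hnr]; push_cast; ring
    have hpos : 0 ≤ m₀ / 2 * ((w : ℝ) + 1) := by positivity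
    linarith
  have c5 : 2 * Real.exp (-(m₀ / 2)) ^ (a + 2) + 6 * (Real.exp x - 1) ≤ 64 * P * D := by
    have h1 : Real.exp x - 1 ≤ 2 * D := by linarith
    have h2 : D ≤ P * D := le_mul_of_one_le_left hD0.le hP1
    nlinarith
  exact ⟨c1, c2, c3, c4, c5⟩

/-- **Rates from two-sided trace domination.**  For an eigenvalue family `0 ≤ λᵢ ≤ λ_{i₀}` with trace formulas
`Z_m = Σ λᵢ^{m+2}`, VDR `λ₀^{m+2} ≤ Z_m` (all `m`) and `Z_m ≤ λ₀^{m+2} exp(E e^{−m₀(m+2)})` (`m + 2 ≤ N`), and the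
threshold `(4/m₀) log(2+E) + 4(w+1) ≤ N` for `N = 2w + a + b' + 6`, `n = w + a + 3`, `2n < N`:
`0 < λ_{i₀}`; the gap `λᵢ ≤ e^{−m₀/2} λ_{i₀}` for `i ≠ i₀`; the long-arc normalised trace
`Σ (λᵢ/λ_{i₀})^{b'+2} ≤ 1 + R` with `R = exp(E e^{−m₀(b'+2)}) − 1 ∈ [0, 1]`; and
`2 (e^{−m₀/2})^{a+2} + 6 R ≤ 64 e^{m₀(w+1)} e^{−(m₀/2) n}`. [folklore] -/
theorem vdr_rates {ι : Type*} {lam : ι → ℝ} {i₀ : ι} (hlam : ∀ i, 0 ≤ lam i ∧ lam i ≤ lam i₀)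
    {Zf : ℕ → ℝ} (hZ : ∀ m, HasSum (fun i => lam i ^ (m + 2)) (Zf m))
    {lam₀ m₀ E : ℝ} (hlam₀ : 0 < lam₀) (hm₀ : 0 < m₀) (hE : 0 ≤ E) {N w n a b' : ℕ}
    (hthr : 4 / m₀ * Real.log (2 + E) + 4 * (w + 1) ≤ (N : ℝ))
    (hlow : ∀ m, lam₀ ^ (m + 2) ≤ Zf m)
    (hup : ∀ m : ℕ, m + 2 ≤ N → Zf m ≤ lam₀ ^ (m + 2) * Real.exp (E * Real.exp (-(m₀ * ((m : ℝ) + 2)))))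
    (hn : 2 * n < N) (hN : N = 2 * w + a + b' + 4 + 2) (hna : w + a + 3 = n) :
    0 < lam i₀ ∧ (∀ i, i ≠ i₀ → lam i ≤ Real.exp (-(m₀ / 2)) * lam i₀) ∧
    ∑' i, (lam i / lam i₀) ^ (b' + 2) ≤ 1 + (Real.exp (E * Real.exp (-(m₀ * ((b' : ℝ) + 2)))) - 1) ∧
    0 ≤ Real.exp (E * Real.exp (-(m₀ * ((b' : ℝ) + 2)))) - 1 ∧
    Real.exp (E * Real.exp (-(m₀ * ((b' : ℝ) + 2)))) - 1 ≤ 1 ∧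
    2 * Real.exp (-(m₀ / 2)) ^ (a + 2) + 6 * (Real.exp (E * Real.exp (-(m₀ * ((b' : ℝ) + 2)))) - 1) ≤
      64 * Real.exp (m₀ * (w + 1)) * Real.exp (-(m₀ / 2 * n)) := by
  obtain ⟨hL, hle⟩ := top_pos_of_vdr hlam hZ hlam₀ hlow
  obtain ⟨c1, c2, c3, c4, c5⟩ := threshold_numerics hm₀ hE hthr hn hN hna
  have hρ0 : ∀ i, 0 ≤ lam i / lam i₀ := fun i => div_nonneg (hlam i).1 hL.le
  have hρ1 : ∀ i, lam i / lam i₀ ≤ 1 := fun i => div_le_one_of_le₀ (hlam i).2 hL.le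
  -- summability of the normalised powers
  have hS2 : Summable fun i => (lam i / lam i₀) ^ 2 := by
    have h := ((hZ 0).div_const (lam i₀ ^ (0 + 2))).summable
    refine h.congr fun i => ?_
    rw [zero_add, div_pow]
  have hSk : ∀ k : ℕ, 2 ≤ k → Summable fun i => (lam i / lam i₀) ^ k := fun k hk =>
    hS2.of_nonneg_of_le (fun i => pow_nonneg (hρ0 i) k) fun i => pow_le_pow_of_le_one (hρ0 i) (hρ1 i) hk
  -- normalised traces
  have hU : ∀ m : ℕ, m + 2 ≤ N → ∑' i, (lam i / lam i₀) ^ (m + 2) ≤ Real.exp (E * Real.exp (-(m₀ * ((m : ℝ) + 2)))) :=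
    fun m hm => tsum_ratio_pow_le hZ hlam₀ hL hle (Real.exp_pos _).le m (hup m hm)
  -- the gap
  have hN2 : 2 ≤ N := by omega
  have hθ : ∀ i, i ≠ i₀ → lam i ≤ Real.exp (-(m₀ / 2)) * lam i₀ := by
    have hUN := hU (N - 2) (by omega)
    have e1 : N - 2 + 2 = N := by omega
    have e2 : ((N - 2 : ℕ) : ℝ) + 2 = N := by
      rw [Nat.cast_sub hN2]; push_cast; ring
    rw [e1, e2] at hUN
    exact ratio_le_of_tsum_pow_le hlam hL (by omega) (hSk N hN2) (Real.exp_pos _).le (by positivity) c1 c2 hUN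
  -- the long arc
  have hb : ∑' i, (lam i / lam i₀) ^ (b' + 2) ≤ Real.exp (E * Real.exp (-(m₀ * ((b' : ℝ) + 2)))) :=
    hU b' (by omega)
  refine ⟨hL, hθ, by linarith, ?_, c4, c5⟩
  have h0 : 0 ≤ E * Real.exp (-(m₀ * ((b' : ℝ) + 2))) := by positivity
  linarith [Real.add_one_le_exp (E * Real.exp (-(m₀ * ((b' : ℝ) + 2))))]

end Literature.Analysis.OperatorTheory

end
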